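import Summits.QuantumAdvantage.QuantumAdvantage.Theorems.NearExactIsExact.Negative.DualPair

/-!
# `NearExactIsExact` (stmt-QuantumAdvantage-14043) — negative lemma: AFFINE SHEARS of a dual pair
  (gen 44 disprover; the kernel-checked core of the `t₀`-invariance observed in the two-sided `naff = 4`
  census, DISPROOF.md §49.5(d))

Cubic-evenness of a parametrised set `S₁ = σ₁(𝔽₂⁵)` (`Σ_v c(σ₁ v) = 0` for every cubic `c`) is invariant
under ANY map `Θ : 𝔽₂ⁿ → 𝔽₂ⁿ` with affine coordinates (`c ∘ Θ` is again cubic): `sum_cubic_affine_image`.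
Consequently a dual pair `(σ₀', σ₁')` (`Negative/DualPair`) whose second set is an affine image
`σ₁' = Θ ∘ σ₁` of a cubic-even set is again a certificate: `dual_pair_shear`, `dual_pair_shear_kill`.

**Why (census N4-CENSUS-1, stratum (I) of the D2 normal form, `N ≡ 0` on both sides).**  For a target
vector `e` with zero frame part and the horizontal sections `S₀(t₀) = H × {t₀}` one has
`τ_e(u,t₀) = τ_e(u,0) ⊕ (0, t₀ ⊕ M′_ë M(u) t₀)` with `M` affine (`M′(x ⊕ ε) = M′(x) ⊕ M′_ë` because the
inverse's fibre matrix `M′` is affine in the target base and `M′(γ u) M(u) = I`), and the base part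
`u ↦ u′ = (ū, ü ⊕ L(ū)⁻¹ë)` of `τ_e(·,0)` is an affine involution; hence
`S₁(t₀) = Θ(S₁(0))` for the affine shear `Θ(v,s) = (v, s ⊕ t₀ ⊕ M′_ë M(v′) t₀)`, which fixes the residual
fibre `U = {v = 0}` setwise.  So the set of good hyperplanes `H` is the same at every fibre level `t₀` —
observed exactly in the census (19 hard maps × 2 sides × 31 levels × 96 vectors `e`: identical solution
sets, `t0inv.py`), and explained by this file's lemma applied to `σ₁ = τ_e ∘ σ₀(0)`, `σ₁' = τ_e ∘ σ₀(t₀)`.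
The D2-specific identity above is paper algebra recorded in DISPROOF.md §49.5(d); only its abstract
consequence is formalised here.

HONEST FRAMING: a kernel-checked folklore invariance lemma on the negative side of `NearExactIsExact`;
NOT summit progress.
-/

set_option linter.dupNamespace false -- D-0017: single-problem summit ⇒ `QuantumAdvantage.QuantumAdvantage` by design

namespace Summit.QuantumAdvantage.QuantumAdvantage.Theorems.NearExactIsExact.Negative.DualPairShear

open Finset
open Literature.Computability.QuantumComplexity
open Literature.Computability.QuantumComplexity.BuzetChailloux (bxor)
open Summit.QuantumAdvantage.QuantumAdvantage.Theorems.CubicForrelation.NearExactIsExact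
  (fc_isDegLeFun_comp)
open Summit.QuantumAdvantage.QuantumAdvantage.Theorems.NearExactIsExact.Negative.SkewProductCore
open Summit.QuantumAdvantage.QuantumAdvantage.Theorems.NearExactIsExact.Negative.DualPair
  (dual_pair dual_pair_kill)

/-- **Cubic-evenness is invariant under affine maps.** If `Σ_v c(σ₁ v) = 0` for every cubic `c` and
every coordinate of `Θ` is affine, then `Σ_v c(Θ(σ₁ v)) = 0` for every cubic `c`. [folklore] -/
theorem sum_cubic_affine_image {m n : ℕ} (σ₁ : (Fin 5 → Bool) → (Fin n → Bool))
    (hS₁ : ∀ c : (Fin n → Bool) → Bool, IsDegLeFun 3 c → ∑ v, ind (c (σ₁ v)) = 0)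
    (Θ : (Fin n → Bool) → (Fin m → Bool)) (hΘ : ∀ j, IsDegLeFun 1 (fun z => Θ z j)) :
    ∀ c : (Fin m → Bool) → Bool, IsDegLeFun 3 c → ∑ v, ind (c (Θ (σ₁ v))) = 0 :=
  fun c hc => hS₁ (fun z => c (Θ z)) (fc_isDegLeFun_comp hc Θ hΘ (by norm_num))

/-- **SHEARED DUAL PAIR (parity).** `c₁ ⊕ c₂∘π = U` with cubic `c₁, c₂`; `σ₀` affine with `π∘σ₀`
quadratic; `σ₁' = Θ ∘ σ₁` with `Θ` affine, `σ₁` cubic-even and `π∘σ₁' = π∘σ₀ ⊕ e` ⇒ even total mass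
on `σ₀, σ₁'`. [folklore] -/
theorem dual_pair_shear {n : ℕ} (π : (Fin n → Bool) → (Fin n → Bool))
    (c₁ c₂ : (Fin n → Bool) → Bool) (h₁ : IsDegLeFun 3 c₁) (h₂ : IsDegLeFun 3 c₂)
    (U : (Fin n → Bool) → Bool) (hres : ∀ z, (c₁ z ^^ c₂ (π z)) = U z)
    (σ₀ σ₁ σ₁' : (Fin 5 → Bool) → (Fin n → Bool)) (hσ₀ : ∀ j, IsDegLeFun 1 (fun v => σ₀ v j))
    (hπ : ∀ j, IsDegLeFun 2 (fun v => π (σ₀ v) j)) (e : Fin n → Bool)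
    (hrefl : ∀ v, π (σ₁' v) = bxor (π (σ₀ v)) e)
    (hS₁ : ∀ c : (Fin n → Bool) → Bool, IsDegLeFun 3 c → ∑ v, ind (c (σ₁ v)) = 0)
    (Θ : (Fin n → Bool) → (Fin n → Bool)) (hΘ : ∀ j, IsDegLeFun 1 (fun z => Θ z j))
    (hshear : ∀ v, σ₁' v = Θ (σ₁ v)) :
    ∑ v, ind (U (σ₀ v)) + ∑ v, ind (U (σ₁' v)) = 0 := by
  refine dual_pair π c₁ c₂ h₁ h₂ U hres σ₀ σ₁' hσ₀ hπ e hrefl ?_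
  intro c hc
  rw [sum_congr rfl (fun v _ => by rw [hshear v])]
  exact sum_cubic_affine_image σ₁ hS₁ Θ hΘ c hc

/-- **SHEARED DUAL PAIR (kill).** In the setting of `dual_pair_shear`, odd total `U`-mass is impossible.
[folklore] -/
theorem dual_pair_shear_kill {n : ℕ} (π : (Fin n → Bool) → (Fin n → Bool))
    (c₁ c₂ : (Fin n → Bool) → Bool) (h₁ : IsDegLeFun 3 c₁) (h₂ : IsDegLeFun 3 c₂)
    (U : (Fin n → Bool) → Bool) (hres : ∀ z, (c₁ z ^^ c₂ (π z)) = U z)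
    (σ₀ σ₁ σ₁' : (Fin 5 → Bool) → (Fin n → Bool)) (hσ₀ : ∀ j, IsDegLeFun 1 (fun v => σ₀ v j))
    (hπ : ∀ j, IsDegLeFun 2 (fun v => π (σ₀ v) j)) (e : Fin n → Bool)
    (hrefl : ∀ v, π (σ₁' v) = bxor (π (σ₀ v)) e)
    (hS₁ : ∀ c : (Fin n → Bool) → Bool, IsDegLeFun 3 c → ∑ v, ind (c (σ₁ v)) = 0)
    (Θ : (Fin n → Bool) → (Fin n → Bool)) (hΘ : ∀ j, IsDegLeFun 1 (fun z => Θ z j))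
    (hshear : ∀ v, σ₁' v = Θ (σ₁ v))
    (hodd : ∑ v, ind (U (σ₀ v)) + ∑ v, ind (U (σ₁' v)) = 1) : False := by
  rw [dual_pair_shear π c₁ c₂ h₁ h₂ U hres σ₀ σ₁ σ₁' hσ₀ hπ e hrefl hS₁ Θ hΘ hshear] at hodd
  exact zero_ne_one hodd

end Summit.QuantumAdvantage.QuantumAdvantage.Theorems.NearExactIsExact.Negative.DualPairShear
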